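import Literature.NumberTheory.Sieve.HeathBrownCubicCubeSums
import Literature.NumberTheory.Sieve.HeathBrownCubicETermRearrangement
import HarnessLib

/-!
# Heath-Brown's Lemma 3.10, §11: the real embedding, units and the window of generators (11.3)

Support for the proof of **Lemma 3.10** of D. R. Heath-Brown, *Primes represented by `x³ + 2y³`*,
Acta Math. 186 (2001), §11 p. 68: "We now replace `R` and `S` by their generators `α` and `β` …
If we take `β` to run over a suitable set `Q'` of non-associated primitive integers of `K` … we
will obtain exactly one value of `α` from each relevant set of associates. … In order to specify a
suitable set of non-associated integers `β` we take `β > 0` and require that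
`N(β)^{1/3} ε₀^{−1/2} < β ≤ N(β)^{1/3} ε₀^{1/2}` (11.3), where `ε₀ = 1 + 2^{1/3} + 4^{1/3}` is the
fundamental unit of `K`", together with the size consequences (11.5)–(11.6):
"`V^{1/3} ≪ |β̂_i| ≪ V^{1/3}`", "`r, s, t ≪ max |α^{(j)}|` … `X V^{−1/3} ≪ |α̂| ≪ X V^{−1/3}`".

We set this up in elementary real terms (no complex embeddings), all PROVED:

* `rho = 2^{1/3}` (`rho_pow_three`, `5/4 < rho < 13/10`); the real embedding as a linear form
  `ell p = p₁ + ρ p₂ + ρ² p₃` on `ℝ³` and the quadratic form `quadQ p = |σ₂(p)|²` written as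
  `a² + b² + c² − ab − bc − ca` (`a, b, c = p₁, ρp₂, ρ²p₃`), with **`ell p · quadQ p = N(p)`**
  (`ell_mul_quadQ`, `N = normForm`), `quadQ ≥ 0`, and the coordinate bound
  `p_i² ≤ (ell² + 2 quadQ)/3` (`sq_coord_le`, `abs_coord_le`);
* the product `mulVec` of coordinate vectors (`coordElt_imulVec`: it is multiplication in
  `ℤ[2^{1/3}]`), multiplicativity `ell_mulVec`, `normForm_mulVec`;
* on `𝓞_K`: `coordVec` (inverse of `coordElt`), `ellO β = ell(β̂)` with `ellO_mul`, and
  `|N(β̂)| = N((β))` (`abs_normForm_coordVec`);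
* units: `epsUnit = 1 + θ + θ²` (`(θ − 1) ε₀ = 1`), `abs_normForm_eq_one_of_isUnit`; the constant
  **`unitE`** `= min {ell(û) : u a unit, 1 < ell(û)}` (a minimum over the finite set of units with
  `|û|_∞ ≤ 2`, `unitE_le_ellO_of_isUnit`: NO unit has `1 < ell(u) < E`; `1 < E < 4`) — we do not
  need to know that `E = ε₀`, i.e. that `ε₀` is fundamental, only that `E` exists;
* **the window** `InWindow T β : T < ell(β̂) ≤ E T` replacing (11.3) (any `T > 0`; Heath-Brown's
  choice is `T = N(β)^{1/3} ε₀^{−1/2}`, ours will be `T = V^{1/3}`): every `β ≠ 0` has an associate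
  in the window (`exists_associated_inWindow`) and only one (`eq_of_associated_of_inWindow`), so
  the window generators are "a suitable set of non-associated integers";
* sizes: for `β̂` in the window with `V < N(β̂) ≤ 2V`, `T³ = V`: `|β̂_i| ≤ 3 V^{1/3}` and
  `|β̂|_∞ > V^{1/3}/4` (`abs_coord_le_of_inWindow`, `exists_abs_coord_gt_of_inWindow`) = (11.5);
  for `α̂` with `α̂ · β̂ = (x, y, 0)`, `X < x, y ≤ 2X`: `|α̂_i| ≤ 7 X V^{−1/3}` and
  `|α̂|_∞ ≥ X/(15 V^{1/3})` (`abs_coord_alpha_le`, `exists_abs_coord_alpha_ge`) = (11.6).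

## References

* D. R. Heath-Brown, *Primes represented by `x³ + 2y³`*, Acta Math. 186 (2001), §11 pp. 68–69,
  (11.3), (11.5), (11.6). [cite: HeathBrownActa2001, §11 (11.3)]
* G. Harman, *Prime-Detecting Sieves*, LMS Monographs 33 (2007), §13.8, (13.8.2), (13.8.4).
  [cite: Harman2007, §13.8]

## Mathlib / tree search

Tree: `normForm` (`HeathBrownCubicSiegelWalfisz`), `castVec`, `mem_latticeCube_iff`
(`HeathBrownCubicCubeSums`), `norm_coordElt`, `absNorm_span_coordElt_real`
(`HeathBrownCubicETermRearrangement`), `coordElt_injective/surjective` (`HeathBrownCubicLatticeCount`).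
Mathlib: `exists_mem_Ioc_zpow`, `Real.rpow_natCast`, `Real.rpow_mul`, `Ideal.absNorm_span_singleton`.
No real-embedding / fundamental-domain material for `ℚ(2^{1/3})` existed (searched `fundamental unit`,
`(𝓞 K)ˣ`, `2 ^ (1/3`).
-/

noncomputable section

open Finset NumberField

namespace Literature.NumberTheory.Sieve.CubicSieve

open LFunctions.CubeRootTwoField CubicPrimes

/-! ### `ρ = 2^{1/3}` and the forms `ell`, `quadQ` -/

/-- `ρ = 2^{1/3} ∈ ℝ`, the real cube root of `2`. [folklore] -/
def rho : ℝ := (2 : ℝ) ^ ((1 : ℝ) / 3)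

/-- `ρ > 0`. [folklore] -/
theorem rho_pos : 0 < rho := Real.rpow_pos_of_pos two_pos _

/-- `ρ³ = 2`. [folklore] -/
theorem rho_pow_three : rho ^ 3 = 2 := by
  rw [rho, ← Real.rpow_natCast, ← Real.rpow_mul (by norm_num)]
  norm_num

/-- `ρ > 5/4` (`(5/4)³ < 2`). [folklore] -/
theorem rho_gt : (5 : ℝ) / 4 < rho := by
  by_contra h
  push Not at h
  have h3 := pow_le_pow_left₀ rho_pos.le h 3
  rw [rho_pow_three] at h3
  norm_num at h3

/-- `ρ < 13/10` (`(13/10)³ > 2`). [folklore] -/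
theorem rho_lt : rho < (13 : ℝ) / 10 := by
  by_contra h
  push Not at h
  have h3 := pow_le_pow_left₀ (by norm_num) h 3
  rw [rho_pow_three] at h3
  norm_num at h3

/-- `1 < ρ`. [folklore] -/
theorem one_lt_rho : 1 < rho := lt_trans (by norm_num) rho_gt

/-- **The real embedding as a linear form on coordinate vectors**:
`ell(p) = p₁ + ρ p₂ + ρ² p₃ = σ₁(p₁ + p₂·2^{1/3} + p₃·4^{1/3})` (Heath-Brown's "`β > 0`",
"`β ≤ N(β)^{1/3}ε₀^{1/2}`" refer to this real number). [cite: HeathBrownActa2001, §11 (11.3)] -/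
def ell (p : ℝ × ℝ × ℝ) : ℝ := p.1 + rho * p.2.1 + rho ^ 2 * p.2.2

/-- **`quadQ(p) = |σ₂(p)|²`**, the squared modulus of the complex embedding, as the real quadratic
form `a² + b² + c² − ab − bc − ca` in `a = p₁`, `b = ρ p₂`, `c = ρ² p₃`. [folklore] -/
def quadQ (p : ℝ × ℝ × ℝ) : ℝ :=
  p.1 ^ 2 + (rho * p.2.1) ^ 2 + (rho ^ 2 * p.2.2) ^ 2 - p.1 * (rho * p.2.1) -
    (rho * p.2.1) * (rho ^ 2 * p.2.2) - (rho ^ 2 * p.2.2) * p.1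

/-- **`ell · quadQ = N`**: `N(p) = σ₁(p) |σ₂(p)|²`, here as the identity
`(a+b+c)(a²+b²+c²−ab−bc−ca) = a³+b³+c³−3abc = p₁³ + 2p₂³ + 4p₃³ − 6p₁p₂p₃`. [folklore] -/
theorem ell_mul_quadQ (p : ℝ × ℝ × ℝ) : ell p * quadQ p = normForm p := by
  have h := rho_pow_three
  simp only [ell, quadQ, normForm]
  linear_combination (p.2.1 ^ 3 + (rho ^ 3 + 2) * p.2.2 ^ 3 - 3 * p.1 * p.2.1 * p.2.2) * h

/-- `quadQ ≥ 0` (`= ½((a−b)² + (b−c)² + (c−a)²)`). [folklore] -/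
theorem quadQ_nonneg (p : ℝ × ℝ × ℝ) : 0 ≤ quadQ p := by
  simp only [quadQ]
  nlinarith [sq_nonneg (p.1 - rho * p.2.1), sq_nonneg (rho * p.2.1 - rho ^ 2 * p.2.2),
    sq_nonneg (rho ^ 2 * p.2.2 - p.1)]

/-- `a² + b² + c² = (ell² + 2 quadQ)/3` for `a, b, c = p₁, ρp₂, ρ²p₃`. [folklore] -/
theorem sum_sq_eq (p : ℝ × ℝ × ℝ) :
    p.1 ^ 2 + (rho * p.2.1) ^ 2 + (rho ^ 2 * p.2.2) ^ 2 = (ell p ^ 2 + 2 * quadQ p) / 3 := by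
  simp only [ell, quadQ]; ring

/-- **Coordinate bounds from the two embeddings**: each of `p₁², p₂², p₃²` is at most
`(ell(p)² + 2 quadQ(p))/3` (as `ρ ≥ 1`). [folklore] -/
theorem sq_coord_le (p : ℝ × ℝ × ℝ) :
    p.1 ^ 2 ≤ (ell p ^ 2 + 2 * quadQ p) / 3 ∧ p.2.1 ^ 2 ≤ (ell p ^ 2 + 2 * quadQ p) / 3 ∧
      p.2.2 ^ 2 ≤ (ell p ^ 2 + 2 * quadQ p) / 3 := by
  have hs := sum_sq_eq p
  have h1 : 1 ≤ rho := one_lt_rho.le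
  have hr2 : p.2.1 ^ 2 ≤ (rho * p.2.1) ^ 2 := by
    rw [mul_pow]; nlinarith [sq_nonneg p.2.1, one_le_pow₀ (n := 2) h1]
  have hr3 : p.2.2 ^ 2 ≤ (rho ^ 2 * p.2.2) ^ 2 := by
    rw [mul_pow]; nlinarith [sq_nonneg p.2.2, one_le_pow₀ (n := 2) (one_le_pow₀ (n := 2) h1)]
  refine ⟨?_, ?_, ?_⟩ <;> nlinarith [sq_nonneg p.1, sq_nonneg (rho * p.2.1), sq_nonneg (rho ^ 2 * p.2.2)]

/-- If `ell(p)² + 2 quadQ(p) ≤ 3R²` then `|p_i| ≤ R` for each coordinate. [folklore] -/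
theorem abs_coord_le {p : ℝ × ℝ × ℝ} {R : ℝ} (hR : 0 ≤ R) (h : ell p ^ 2 + 2 * quadQ p ≤ 3 * R ^ 2) :
    |p.1| ≤ R ∧ |p.2.1| ≤ R ∧ |p.2.2| ≤ R := by
  obtain ⟨h1, h2, h3⟩ := sq_coord_le p
  have hb : (ell p ^ 2 + 2 * quadQ p) / 3 ≤ R ^ 2 := by linarith
  exact ⟨abs_le_of_sq_le_sq' (h1.trans hb) hR |>.elim (fun a b => abs_le.mpr ⟨a, b⟩),
    abs_le_of_sq_le_sq' (h2.trans hb) hR |>.elim (fun a b => abs_le.mpr ⟨a, b⟩),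
    abs_le_of_sq_le_sq' (h3.trans hb) hR |>.elim (fun a b => abs_le.mpr ⟨a, b⟩)⟩

/-- `ell(p) ≤ (1 + ρ + ρ²) |p|_∞ < 4 max |p_i|`: a lower bound for the sup norm from the real
embedding. [folklore] -/
theorem ell_lt_four_mul {p : ℝ × ℝ × ℝ} {M : ℝ} (h1 : |p.1| ≤ M) (h2 : |p.2.1| ≤ M) (h3 : |p.2.2| ≤ M)
    (hM : 0 < M) : ell p < 4 * M := by
  have hr := rho_lt
  have hr0 := rho_pos
  simp only [ell]
  have a1 := (abs_le.mp h1).2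
  have a2 := (abs_le.mp h2).2
  have a3 := (abs_le.mp h3).2
  have b2 : rho * p.2.1 ≤ rho * M := mul_le_mul_of_nonneg_left a2 hr0.le
  have b3 : rho ^ 2 * p.2.2 ≤ rho ^ 2 * M := mul_le_mul_of_nonneg_left a3 (by positivity)
  have hsum : 1 + rho + rho ^ 2 < 4 := by nlinarith
  have hlt : M * (1 + rho + rho ^ 2) < M * 4 := mul_lt_mul_of_pos_left hsum hM
  nlinarith

/-! ### Multiplication of coordinate vectors -/

/-- The product of coordinate vectors: `(r,s,t)·(u,v,w) = (ru+2sw+2tv, rv+su+2tw, rw+sv+tu)`,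
the coordinates of `(r + sθ + tθ²)(u + vθ + wθ²)` (`θ³ = 2`). [folklore] -/
def mulVec (a b : ℝ × ℝ × ℝ) : ℝ × ℝ × ℝ :=
  (a.1 * b.1 + 2 * a.2.1 * b.2.2 + 2 * a.2.2 * b.2.1,
    a.1 * b.2.1 + a.2.1 * b.1 + 2 * a.2.2 * b.2.2,
    a.1 * b.2.2 + a.2.1 * b.2.1 + a.2.2 * b.1)

/-- The same product on integer vectors. [folklore] -/
def imulVec (a b : ℤ × ℤ × ℤ) : ℤ × ℤ × ℤ :=
  (a.1 * b.1 + 2 * a.2.1 * b.2.2 + 2 * a.2.2 * b.2.1,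
    a.1 * b.2.1 + a.2.1 * b.1 + 2 * a.2.2 * b.2.2,
    a.1 * b.2.2 + a.2.1 * b.2.1 + a.2.2 * b.1)

/-- `castVec` is multiplicative. [folklore] -/
theorem castVec_imulVec (a b : ℤ × ℤ × ℤ) : castVec (imulVec a b) = mulVec (castVec a) (castVec b) := by
  simp only [castVec, imulVec, mulVec]
  push_cast
  ring_nf

/-- **`coordElt` is multiplicative for `imulVec`**: the product formula in `ℤ[2^{1/3}]`. [folklore] -/
theorem coordElt_imulVec (a b : ℤ × ℤ × ℤ) : coordElt (imulVec a b) = coordElt a * coordElt b := by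
  have h3 : (θint : 𝓞 K) ^ 3 = 2 := by
    apply RingOfIntegers.coe_injective
    simp [θ_pow_three, map_ofNat]
  simp only [coordElt, imulVec]
  push_cast
  linear_combination (-((a.2.1 : 𝓞 K) * b.2.2 + a.2.2 * b.2.1 + (a.2.2 : 𝓞 K) * b.2.2 * θint)) * h3

/-- `ell` is multiplicative: `σ₁(αβ) = σ₁(α) σ₁(β)`. [folklore] -/
theorem ell_mulVec (a b : ℝ × ℝ × ℝ) : ell (mulVec a b) = ell a * ell b := by
  have h := rho_pow_three
  simp only [ell, mulVec]
  linear_combination (-(a.2.1 * b.2.2 + a.2.2 * b.2.1 + rho * a.2.2 * b.2.2)) * h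

/-- The norm form is multiplicative. [folklore] -/
theorem normForm_mulVec (a b : ℝ × ℝ × ℝ) : normForm (mulVec a b) = normForm a * normForm b := by
  simp only [normForm, mulVec]; ring

/-- `ell` is additive and homogeneous (a linear form). [folklore] -/
theorem ell_neg (p : ℝ × ℝ × ℝ) : ell (-p) = -ell p := by
  simp only [ell, Prod.fst_neg, Prod.snd_neg]; ring

/-! ### Coordinates of elements of `𝓞_K` -/

/-- The coordinate vector `β̂` of `β ∈ 𝓞_K = ℤ[2^{1/3}]` (inverse of `coordElt`). [folklore] -/
def coordVec (β : 𝓞 K) : ℤ × ℤ × ℤ := (coordElt_surjective β).choose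

/-- `coordElt (coordVec β) = β`. [folklore] -/
@[simp] theorem coordElt_coordVec (β : 𝓞 K) : coordElt (coordVec β) = β :=
  (coordElt_surjective β).choose_spec

/-- `coordVec (coordElt v) = v`. [folklore] -/
@[simp] theorem coordVec_coordElt (v : ℤ × ℤ × ℤ) : coordVec (coordElt v) = v :=
  coordElt_injective (coordElt_coordVec _)

/-- `coordVec` is multiplicative for `imulVec`. [folklore] -/
theorem coordVec_mul (β γ : 𝓞 K) : coordVec (β * γ) = imulVec (coordVec β) (coordVec γ) := by
  apply coordElt_injective
  rw [coordElt_coordVec, coordElt_imulVec, coordElt_coordVec, coordElt_coordVec]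

/-- `coordVec 1 = (1, 0, 0)`. [folklore] -/
@[simp] theorem coordVec_one : coordVec (1 : 𝓞 K) = (1, 0, 0) := by
  apply coordElt_injective
  rw [coordElt_coordVec]; simp [coordElt]

/-- `coordVec (−β) = −coordVec β`. [folklore] -/
theorem coordVec_neg (β : 𝓞 K) : coordVec (-β) = -coordVec β := by
  apply coordElt_injective
  rw [coordElt_coordVec]
  have : -coordVec β = (-1 : ℤ) • coordVec β := by simp
  rw [this, coordElt_smul, coordElt_coordVec]; simp

/-- **`ellO β = σ₁(β)`**, the real embedding of `β ∈ 𝓞_K`, via coordinates. [cite: HeathBrownActa2001, §11 (11.3)] -/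
def ellO (β : 𝓞 K) : ℝ := ell (castVec (coordVec β))

/-- `ellO (coordElt v) = ell v̂`. [folklore] -/
@[simp] theorem ellO_coordElt (v : ℤ × ℤ × ℤ) : ellO (coordElt v) = ell (castVec v) := by
  rw [ellO, coordVec_coordElt]

/-- `ellO` is multiplicative. [folklore] -/
theorem ellO_mul (β γ : 𝓞 K) : ellO (β * γ) = ellO β * ellO γ := by
  rw [ellO, coordVec_mul, castVec_imulVec, ell_mulVec]; rfl

/-- `ellO 1 = 1`. [folklore] -/
@[simp] theorem ellO_one : ellO (1 : 𝓞 K) = 1 := by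
  rw [ellO, coordVec_one]; simp [castVec, ell]

/-- `ellO (−β) = −ellO β`. [folklore] -/
theorem ellO_neg (β : 𝓞 K) : ellO (-β) = -ellO β := by
  rw [ellO, coordVec_neg]
  have : castVec (-coordVec β) = -castVec (coordVec β) := by
    simp only [castVec, Prod.fst_neg, Prod.snd_neg, Int.cast_neg]; rfl
  rw [this, ell_neg]; rfl

/-- `ellO (β^n) = (ellO β)^n`. [folklore] -/
theorem ellO_pow (β : 𝓞 K) (n : ℕ) : ellO (β ^ n) = ellO β ^ n := by
  induction n with
  | zero => simp
  | succ n ih => rw [pow_succ, ellO_mul, ih, pow_succ]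

/-- **`|N(β̂)| = N((β))`** for `β ∈ 𝓞_K`. [folklore] -/
theorem abs_normForm_coordVec (β : 𝓞 K) :
    |normForm (castVec (coordVec β))| = (Ideal.absNorm (Ideal.span {β}) : ℝ) := by
  conv_rhs => rw [← coordElt_coordVec β]
  rw [absNorm_span_coordElt_real]; rfl

/-- `N(β̂) ≠ 0` for `β ≠ 0`. [folklore] -/
theorem normForm_coordVec_ne_zero {β : 𝓞 K} (hβ : β ≠ 0) : normForm (castVec (coordVec β)) ≠ 0 := by
  intro h
  have h1 := abs_normForm_coordVec β
  rw [h, abs_zero] at h1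
  have : Ideal.absNorm (Ideal.span {β}) = 0 := by exact_mod_cast h1.symm
  rw [Ideal.absNorm_eq_zero_iff, Ideal.span_singleton_eq_bot] at this
  exact hβ this

/-- `σ₁(β) ≠ 0` for `β ≠ 0` (as `σ₁(β) |σ₂(β)|² = N(β) ≠ 0`). [folklore] -/
theorem ellO_ne_zero {β : 𝓞 K} (hβ : β ≠ 0) : ellO β ≠ 0 := by
  intro h
  apply normForm_coordVec_ne_zero hβ
  rw [← ell_mul_quadQ, show ell (castVec (coordVec β)) = ellO β from rfl, h, zero_mul]

/-! ### Units -/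

/-- **Heath-Brown's unit `ε₀ = 1 + 2^{1/3} + 4^{1/3}`** with inverse `2^{1/3} − 1`
(`(θ − 1)(1 + θ + θ²) = θ³ − 1 = 1`). [cite: HeathBrownActa2001, §11 (11.3)] -/
def epsUnit : (𝓞 K)ˣ where
  val := 1 + θint + θint ^ 2
  inv := θint - 1
  val_inv := by
    have h3 : (θint : 𝓞 K) ^ 3 = 2 := by
      apply RingOfIntegers.coe_injective
      simp [θ_pow_three, map_ofNat]
    linear_combination h3
  inv_val := by
    have h3 : (θint : 𝓞 K) ^ 3 = 2 := by
      apply RingOfIntegers.coe_injective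
      simp [θ_pow_three, map_ofNat]
    linear_combination h3

/-- `ε₀ = coordElt (1, 1, 1)`. [folklore] -/
theorem coe_epsUnit : (epsUnit : 𝓞 K) = coordElt (1, 1, 1) := by
  simp [epsUnit, coordElt]

/-- `σ₁(ε₀) = 1 + ρ + ρ²`. [folklore] -/
theorem ellO_epsUnit : ellO (epsUnit : 𝓞 K) = 1 + rho + rho ^ 2 := by
  rw [coe_epsUnit, ellO_coordElt]; simp [castVec, ell]

/-- `1 < σ₁(ε₀) < 4`. [folklore] -/
theorem ellO_epsUnit_bounds : 1 < ellO (epsUnit : 𝓞 K) ∧ ellO (epsUnit : 𝓞 K) < 4 := by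
  rw [ellO_epsUnit]
  have := rho_pos; have := rho_lt
  constructor <;> nlinarith

/-- **Units have `|N(û)| = 1`.** [folklore] -/
theorem abs_normForm_eq_one_of_isUnit {u : 𝓞 K} (hu : IsUnit u) :
    |normForm (castVec (coordVec u))| = 1 := by
  rw [abs_normForm_coordVec]
  have : Ideal.span {u} = ⊤ := Ideal.span_singleton_eq_top.mpr hu
  rw [this, Ideal.absNorm_top]; simp

/-- For a unit `u` with `σ₁(u) > 0`: `N(û) = 1` and `quadQ(û) = 1/σ₁(u)`. [folklore] -/
theorem normForm_eq_one_of_isUnit {u : 𝓞 K} (hu : IsUnit u) (hpos : 0 < ellO u) :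
    normForm (castVec (coordVec u)) = 1 ∧ quadQ (castVec (coordVec u)) = (ellO u)⁻¹ := by
  have h1 := abs_normForm_eq_one_of_isUnit hu
  have hprod := ell_mul_quadQ (castVec (coordVec u))
  have hQ := quadQ_nonneg (castVec (coordVec u))
  have hell : ell (castVec (coordVec u)) = ellO u := rfl
  rw [hell] at hprod
  have hN0 : 0 ≤ normForm (castVec (coordVec u)) := by rw [← hprod]; positivity
  rw [abs_of_nonneg hN0] at h1
  refine ⟨h1, ?_⟩
  rw [h1] at hprod
  field_simp
  linarith

open scoped Classical in
/-- The finite set of unit coordinate vectors `û` with `|û_i| ≤ 2` and `σ₁(u) > 1` (it contains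
`ε̂₀ = (1,1,1)`, and — see `mem_unitBox_of_isUnit` — every unit with `1 < σ₁(u) < 4`). [folklore] -/
def unitBox : Finset (ℤ × ℤ × ℤ) :=
  (Icc (-2 : ℤ) 2 ×ˢ (Icc (-2 : ℤ) 2 ×ˢ Icc (-2 : ℤ) 2)).filter
    fun v => IsUnit (coordElt v) ∧ 1 < ell (castVec v)

/-- `(1,1,1) ∈ unitBox`. [folklore] -/
theorem one_one_one_mem_unitBox : ((1 : ℤ), (1 : ℤ), (1 : ℤ)) ∈ unitBox := by
  classical
  rw [unitBox, mem_filter]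
  refine ⟨by simp, ?_, ?_⟩
  · rw [← coe_epsUnit]; exact Units.isUnit _
  · have h := ellO_epsUnit_bounds.1
    rwa [coe_epsUnit, ellO_coordElt] at h

/-- **Every unit with `1 < σ₁(u) < 4` lies in `unitBox`**: `N(û) = 1`, `quadQ(û) = 1/σ₁(u) < 1`,
so `û_i² ≤ (16 + 2)/3 = 6`, `|û_i| ≤ 2`. [folklore] -/
theorem mem_unitBox_of_isUnit {u : 𝓞 K} (hu : IsUnit u) (h1 : 1 < ellO u) (h4 : ellO u < 4) :
    coordVec u ∈ unitBox := by
  classical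
  obtain ⟨-, hQ⟩ := normForm_eq_one_of_isUnit hu (by linarith)
  have hQ1 : quadQ (castVec (coordVec u)) < 1 := by
    rw [hQ]; exact inv_lt_one_of_one_lt₀ h1
  have hell : ell (castVec (coordVec u)) = ellO u := rfl
  obtain ⟨b1, b2, b3⟩ := sq_coord_le (castVec (coordVec u))
  rw [hell] at b1 b2 b3
  have hbound : (ellO u ^ 2 + 2 * quadQ (castVec (coordVec u))) / 3 < 9 := by nlinarith
  have key : ∀ z : ℤ, ((z : ℝ)) ^ 2 < 9 → z ∈ Icc (-2 : ℤ) 2 := by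
    intro z hz
    have hz3 : |(z : ℝ)| < 3 := by
      rw [show (9 : ℝ) = 3 ^ 2 by norm_num] at hz
      exact abs_lt_of_sq_lt_sq hz (by norm_num)
    rw [abs_lt] at hz3
    obtain ⟨hl, hr⟩ := hz3
    have hl' : (-3 : ℤ) < z := by exact_mod_cast hl
    have hr' : z < (3 : ℤ) := by exact_mod_cast hr
    rw [mem_Icc]; omega
  rw [unitBox, mem_filter, mem_product, mem_product]
  refine ⟨⟨key _ (by simpa [castVec] using b1.trans_lt hbound),
    key _ (by simpa [castVec] using b2.trans_lt hbound),
    key _ (by simpa [castVec] using b3.trans_lt hbound)⟩, ?_, ?_⟩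
  · rwa [coordElt_coordVec]
  · rw [hell]; exact h1

/-- **The constant `E`**: the least value `σ₁(u) > 1` over the units `u` of `unitBox` (hence, by
`unitE_le_ellO_of_isUnit`, over all units). It plays the role of Heath-Brown's `ε₀` in (11.3); we
only use `1 < E < 4`. [cite: HeathBrownActa2001, §11 (11.3)] -/
def unitE : ℝ := (unitBox.image fun v => ell (castVec v)).min' ⟨_, mem_image_of_mem _ one_one_one_mem_unitBox⟩

/-- `E` is attained: `E = σ₁(u_E)` for some unit `u_E`. [folklore] -/
theorem exists_unit_ellO_eq_unitE : ∃ u : (𝓞 K)ˣ, ellO (u : 𝓞 K) = unitE := by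
  classical
  have hmem := Finset.min'_mem (unitBox.image fun v => ell (castVec v))
    ⟨_, mem_image_of_mem _ one_one_one_mem_unitBox⟩
  obtain ⟨v, hv, hvE⟩ := mem_image.mp hmem
  rw [unitBox, mem_filter] at hv
  refine ⟨hv.2.1.unit, ?_⟩
  rw [IsUnit.unit_spec, ellO_coordElt]
  exact hvE

/-- `1 < E`. [folklore] -/
theorem one_lt_unitE : 1 < unitE := by
  classical
  have hmem := Finset.min'_mem (unitBox.image fun v => ell (castVec v))
    ⟨_, mem_image_of_mem _ one_one_one_mem_unitBox⟩
  obtain ⟨v, hv, hvE⟩ := mem_image.mp hmem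
  rw [unitBox, mem_filter] at hv
  rw [unitE, ← hvE]; exact hv.2.2

/-- `E ≤ σ₁(ε₀) < 4`. [folklore] -/
theorem unitE_lt_four : unitE < 4 := by
  classical
  have hle : unitE ≤ ell (castVec ((1 : ℤ), (1 : ℤ), (1 : ℤ))) :=
    Finset.min'_le _ _ (mem_image_of_mem _ one_one_one_mem_unitBox)
  have h4 := ellO_epsUnit_bounds.2
  rw [coe_epsUnit, ellO_coordElt] at h4
  exact lt_of_le_of_lt hle h4

/-- `0 < E`. [folklore] -/
theorem unitE_pos : 0 < unitE := lt_trans one_pos one_lt_unitE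

/-- **No unit has `1 < σ₁(u) < E`**: `E ≤ σ₁(u)` for every unit `u` with `σ₁(u) > 1`. [folklore] -/
theorem unitE_le_ellO_of_isUnit {u : 𝓞 K} (hu : IsUnit u) (h1 : 1 < ellO u) : unitE ≤ ellO u := by
  classical
  by_cases h4 : ellO u < 4
  · have hmem := mem_unitBox_of_isUnit hu h1 h4
    have := Finset.min'_le (unitBox.image fun v => ell (castVec v)) _ (mem_image_of_mem _ hmem)
    exact this
  · push Not at h4
    exact (unitE_lt_four.le.trans h4)

/-- For a unit `u`: `σ₁(u⁻¹) = σ₁(u)⁻¹`. [folklore] -/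
theorem ellO_units_inv (u : (𝓞 K)ˣ) : ellO ((u⁻¹ : (𝓞 K)ˣ) : 𝓞 K) = (ellO (u : 𝓞 K))⁻¹ := by
  have h : ellO ((u : 𝓞 K)) * ellO ((u⁻¹ : (𝓞 K)ˣ) : 𝓞 K) = 1 := by
    rw [← ellO_mul, Units.mul_inv, ellO_one]
  have hne : ellO (u : 𝓞 K) ≠ 0 := ellO_ne_zero (Units.ne_zero u)
  field_simp
  linarith [h]

/-- **A unit with `σ₁(u) ∈ (E⁻¹, E)` and `σ₁(u) > 0` is `1`.** If `1 < σ₁(u)` this contradicts the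
minimality of `E`; if `σ₁(u) < 1` apply the same to `u⁻¹`; so `σ₁(u) = 1`, whence `N(û) = 1`,
`quadQ(û) = 1`, `û₁² + ρ²û₂² + ρ⁴û₃² = 1`, forcing `û = (1, 0, 0)`. [folklore] -/
theorem units_eq_one_of_ellO_mem {u : (𝓞 K)ˣ} (hpos : 0 < ellO (u : 𝓞 K))
    (hlo : unitE⁻¹ < ellO (u : 𝓞 K)) (hhi : ellO (u : 𝓞 K) < unitE) : u = 1 := by
  have hE1 := one_lt_unitE
  -- `σ₁(u) = 1`
  have heq : ellO (u : 𝓞 K) = 1 := by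
    rcases lt_trichotomy (ellO (u : 𝓞 K)) 1 with hlt | heq | hgt
    · exfalso
      have hinv := ellO_units_inv u
      have h1 : 1 < ellO ((u⁻¹ : (𝓞 K)ˣ) : 𝓞 K) := by
        rw [hinv]; exact one_lt_inv_iff₀.mpr ⟨hpos, hlt⟩
      have hle := unitE_le_ellO_of_isUnit (Units.isUnit u⁻¹) h1
      rw [hinv] at hle
      have : ellO (u : 𝓞 K) ≤ unitE⁻¹ := by
        have h := inv_anti₀ unitE_pos hle
        rwa [inv_inv] at h
      linarith
    · exact heq
    · exfalso
      have hle := unitE_le_ellO_of_isUnit (Units.isUnit u) hgt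
      linarith
  -- hence `û = (1,0,0)`
  obtain ⟨-, hQ⟩ := normForm_eq_one_of_isUnit (Units.isUnit u) hpos
  rw [heq, inv_one] at hQ
  obtain ⟨v, hv⟩ : ∃ v, coordVec (u : 𝓞 K) = v := ⟨_, rfl⟩
  have hs := sum_sq_eq (castVec v)
  have hell : ell (castVec v) = 1 := by rw [← hv]; exact heq
  rw [hv] at hQ
  rw [hell, hQ] at hs
  simp only [castVec] at hs
  norm_num at hs
  -- integer coordinates
  have hr := one_lt_rho
  have hr2 : 1 < rho ^ 2 := by nlinarith
  have hv2 : v.2.1 = 0 := by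
    by_contra hne
    have h1 : (1 : ℝ) ≤ (v.2.1 : ℝ) ^ 2 := by
      have : (1 : ℤ) ≤ v.2.1 ^ 2 := by nlinarith [sq_pos_of_ne_zero hne]
      exact_mod_cast this
    have : (rho * (v.2.1 : ℝ)) ^ 2 > 1 := by rw [mul_pow]; nlinarith
    nlinarith [sq_nonneg (v.1 : ℝ), sq_nonneg (rho ^ 2 * (v.2.2 : ℝ))]
  have hv3 : v.2.2 = 0 := by
    by_contra hne
    have h1 : (1 : ℝ) ≤ (v.2.2 : ℝ) ^ 2 := by
      have : (1 : ℤ) ≤ v.2.2 ^ 2 := by nlinarith [sq_pos_of_ne_zero hne]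
      exact_mod_cast this
    have : (rho ^ 2 * (v.2.2 : ℝ)) ^ 2 > 1 := by rw [mul_pow]; nlinarith
    nlinarith [sq_nonneg (v.1 : ℝ), sq_nonneg (rho * (v.2.1 : ℝ))]
  have hv1 : v.1 = 1 := by
    have h := hell
    simp only [ell, castVec, hv2, hv3, Int.cast_zero, mul_zero, add_zero] at h
    exact_mod_cast h
  apply Units.ext
  have : (u : 𝓞 K) = coordElt v := by rw [← hv, coordElt_coordVec]
  rw [this, Units.val_one]
  have hv' : v = (1, 0, 0) := Prod.ext hv1 (Prod.ext hv2 hv3)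
  rw [hv']; simp [coordElt]

/-! ### The window of generators (Heath-Brown's (11.3)) -/

/-- **The window condition** `T < σ₁(β) ≤ E·T` on `β ∈ 𝓞_K` — our rendering of the fundamental
domain (11.3) "`N(β)^{1/3} ε₀^{−1/2} < β ≤ N(β)^{1/3} ε₀^{1/2}`" for the action of the units on
generators (we use a fixed `T`, later `T = V^{1/3}`, for all `β` with `V < N(β) ≤ 2V`).
[cite: HeathBrownActa2001, §11 (11.3)] -/
def InWindow (T : ℝ) (β : 𝓞 K) : Prop := T < ellO β ∧ ellO β ≤ unitE * T

/-- **Existence of a window associate**: every `β ≠ 0` has an associate `u β` (`u` a unit) with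
`T < σ₁(uβ) ≤ E T` ("we will obtain exactly one value of `α` from each relevant set of associates",
p. 68 — existence half). [cite: HeathBrownActa2001, §11 p. 68] -/
theorem exists_associated_inWindow {T : ℝ} (hT : 0 < T) {β : 𝓞 K} (hβ : β ≠ 0) :
    ∃ u : (𝓞 K)ˣ, InWindow T ((u : 𝓞 K) * β) := by
  obtain ⟨uE, huE⟩ := exists_unit_ellO_eq_unitE
  have hE1 := one_lt_unitE
  -- first make `σ₁(β) > 0`
  obtain ⟨s, hs⟩ : ∃ s : (𝓞 K)ˣ, 0 < ellO ((s : 𝓞 K) * β) := by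
    rcases lt_or_gt_of_ne (ellO_ne_zero hβ) with h | h
    · refine ⟨-1, ?_⟩
      rw [Units.val_neg, Units.val_one, neg_one_mul, ellO_neg]; linarith
    · exact ⟨1, by rw [Units.val_one, one_mul]; exact h⟩
  set x := ellO ((s : 𝓞 K) * β) with hx
  obtain ⟨n, hn1, hn2⟩ := exists_mem_Ioc_zpow (div_pos hs hT) hE1
  -- multiply by `uE^{-n}`
  have hpowE : ∀ k : ℕ, ellO ((uE ^ k : (𝓞 K)ˣ) : 𝓞 K) = unitE ^ k := fun k => by
    rw [Units.val_pow_eq_pow_val, ellO_pow, huE]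
  rcases le_or_gt 0 n with hn | hn
  · -- `n ≥ 0`: use `(uE⁻¹)^n`
    obtain ⟨k, rfl⟩ := Int.eq_ofNat_of_zero_le hn
    refine ⟨(uE⁻¹) ^ k * s, ?_⟩
    have hval : ellO ((((uE⁻¹) ^ k * s : (𝓞 K)ˣ) : 𝓞 K) * β) = (unitE ^ k)⁻¹ * x := by
      rw [Units.val_mul, mul_assoc, ellO_mul, ← hx, ← inv_pow, Units.val_pow_eq_pow_val, ellO_pow,
        ellO_units_inv, huE, inv_pow]
    rw [InWindow, hval]
    rw [zpow_natCast] at hn1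
    rw [zpow_add_one₀ (by positivity), zpow_natCast] at hn2
    have hEk : 0 < unitE ^ k := by positivity
    constructor
    · rw [lt_div_iff₀ hT] at hn1
      rw [show T = (unitE ^ k)⁻¹ * (unitE ^ k * T) by field_simp]
      exact mul_lt_mul_of_pos_left hn1 (inv_pos.mpr hEk)
    · rw [div_le_iff₀ hT] at hn2
      calc (unitE ^ k)⁻¹ * x ≤ (unitE ^ k)⁻¹ * (unitE ^ k * unitE * T) :=
            mul_le_mul_of_nonneg_left hn2 (inv_pos.mpr hEk).le
        _ = unitE * T := by field_simp
  · -- `n < 0`: use `uE^{-n}`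
    obtain ⟨k, hk⟩ := Int.exists_eq_neg_ofNat hn.le
    refine ⟨uE ^ k * s, ?_⟩
    have hval : ellO (((uE ^ k * s : (𝓞 K)ˣ) : 𝓞 K) * β) = unitE ^ k * x := by
      rw [Units.val_mul, mul_assoc, ellO_mul, ← hx, hpowE]
    rw [InWindow, hval]
    rw [hk, zpow_neg, zpow_natCast] at hn1
    rw [hk, show -(k : ℤ) + 1 = -((k : ℤ) - 1) by ring, zpow_neg] at hn2
    have hEk : 0 < unitE ^ k := by positivity
    have hk1 : 1 ≤ k := by omega
    constructor
    · rw [lt_div_iff₀ hT] at hn1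
      calc T = unitE ^ k * ((unitE ^ k)⁻¹ * T) := by field_simp
        _ < unitE ^ k * x := mul_lt_mul_of_pos_left hn1 hEk
    · rw [div_le_iff₀ hT] at hn2
      have hz : (unitE ^ ((k : ℤ) - 1))⁻¹ = (unitE ^ (k - 1))⁻¹ := by
        rw [show ((k : ℤ) - 1) = ((k - 1 : ℕ) : ℤ) by push_cast [Nat.cast_sub hk1]; ring, zpow_natCast]
      rw [hz] at hn2
      have hpk : unitE ^ k = unitE ^ (k - 1) * unitE := by
        rw [← pow_succ, Nat.sub_add_cancel hk1]
      calc unitE ^ k * x ≤ unitE ^ k * ((unitE ^ (k - 1))⁻¹ * T) :=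
            mul_le_mul_of_nonneg_left hn2 hEk.le
        _ = unitE * T := by rw [hpk]; field_simp

/-- **Uniqueness of the window associate**: two associates in the same window are equal ("exactly
one value … from each relevant set of associates", p. 68 — uniqueness half).
[cite: HeathBrownActa2001, §11 p. 68] -/
theorem eq_of_associated_of_inWindow {T : ℝ} (hT : 0 < T) {β : 𝓞 K} (u : (𝓞 K)ˣ)
    (h₁ : InWindow T β) (h₂ : InWindow T ((u : 𝓞 K) * β)) : (u : 𝓞 K) * β = β := by
  obtain ⟨a1, a2⟩ := h₁
  obtain ⟨b1, b2⟩ := h₂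
  rw [ellO_mul] at b1 b2
  have hβ : 0 < ellO β := lt_trans hT a1
  have hE := one_lt_unitE
  have hu_pos : 0 < ellO (u : 𝓞 K) := by
    by_contra h; push Not at h
    have : ellO (u : 𝓞 K) * ellO β ≤ 0 := mul_nonpos_of_nonpos_of_nonneg h hβ.le
    linarith
  have hhi : ellO (u : 𝓞 K) < unitE := by
    by_contra h; push Not at h
    have : unitE * ellO β ≤ ellO (u : 𝓞 K) * ellO β := mul_le_mul_of_nonneg_right h hβ.le
    nlinarith
  have hlo : unitE⁻¹ < ellO (u : 𝓞 K) := by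
    by_contra h; push Not at h
    have h' : ellO (u : 𝓞 K) * ellO β ≤ unitE⁻¹ * ellO β := mul_le_mul_of_nonneg_right h hβ.le
    have h'' : unitE⁻¹ * ellO β ≤ unitE⁻¹ * (unitE * T) :=
      mul_le_mul_of_nonneg_left a2 (inv_pos.mpr unitE_pos).le
    rw [← mul_assoc, inv_mul_cancel₀ unitE_pos.ne', one_mul] at h''
    linarith
  rw [units_eq_one_of_ellO_mem hu_pos hlo hhi, Units.val_one, one_mul]

/-! ### Sizes: (11.5) and (11.6) -/

/-- **(11.5), upper bound**: if `T < ell(p) ≤ E T`, `0 < N(p) ≤ 2V` and `T³ = V` (`T > 0`) then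
`|p_i| ≤ 3 V^{1/3} = 3T` ("`|β̂_i| ≪ V^{1/3}`"). [cite: HeathBrownActa2001, §11 (11.5)] -/
theorem abs_coord_le_of_inWindow {p : ℝ × ℝ × ℝ} {T V : ℝ} (hT : 0 < T) (hTV : T ^ 3 = V)
    (h1 : T < ell p) (h2 : ell p ≤ unitE * T) (hN : normForm p ≤ 2 * V) :
    |p.1| ≤ 3 * T ∧ |p.2.1| ≤ 3 * T ∧ |p.2.2| ≤ 3 * T := by
  have hE4 := unitE_lt_four
  have hprod := ell_mul_quadQ p
  have hell0 : 0 < ell p := lt_trans hT h1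
  have hQ : quadQ p ≤ 2 * T ^ 2 := by
    -- `quadQ = N/ell < 2V/T = 2T²`
    have : ell p * quadQ p ≤ T * (2 * T ^ 2) := by rw [hprod]; nlinarith
    by_contra h; push Not at h
    have : T * (2 * T ^ 2) < ell p * quadQ p := by
      calc T * (2 * T ^ 2) < ell p * (2 * T ^ 2) := by gcongr
        _ ≤ ell p * quadQ p := by gcongr
    linarith
  have hell4 : ell p < 4 * T := by nlinarith
  apply abs_coord_le (by positivity)
  nlinarith [quadQ_nonneg p]

/-- **(11.5), lower bound**: if `T < ell(p)` then some coordinate has `|p_i| > T/4`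
("`V^{1/3} ≪ |β̂_i|`"). [cite: HeathBrownActa2001, §11 (11.5)] -/
theorem exists_abs_coord_gt_of_inWindow {p : ℝ × ℝ × ℝ} {T : ℝ} (hT : 0 < T) (h1 : T < ell p) :
    T / 4 < max |p.1| (max |p.2.1| |p.2.2|) := by
  by_contra h; push Not at h
  have hM : 0 < T / 4 := by positivity
  have := ell_lt_four_mul (le_trans (le_max_left _ _) h)
    (le_trans ((le_max_left _ _).trans (le_max_right _ _)) h)
    (le_trans ((le_max_right _ _).trans (le_max_right _ _)) h) hM
  linarith

/-- **(11.6), upper bound**: if `α̂ β̂ = (x, y, 0)` with `X < x, y ≤ 2X` (`X > 0`), `β̂` in the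
window `T < ell ≤ E T` with `V < N(β̂)`, `T³ = V`, then `|α̂_i| ≤ 7 X / T = 7 X V^{−1/3}`
("`r, s, t ≪ max |α^{(j)}|` and `α^{(j)}β^{(j)} ≪ X`, `|β^{(j)}| ≫ V^{1/3}`").
[cite: HeathBrownActa2001, §11 (11.6)] -/
theorem abs_coord_alpha_le {a b : ℝ × ℝ × ℝ} {X T V x y : ℝ} (hX : 0 < X) (hT : 0 < T)
    (hTV : T ^ 3 = V) (hb1 : T < ell b) (hb2 : ell b ≤ unitE * T) (hNb1 : V < normForm b)
    (hab : mulVec a b = (x, y, 0)) (hx1 : X < x) (hx2 : x ≤ 2 * X)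
    (hy1 : X < y) (hy2 : y ≤ 2 * X) :
    |a.1| ≤ 7 * X / T ∧ |a.2.1| ≤ 7 * X / T ∧ |a.2.2| ≤ 7 * X / T := by
  have hE4 := unitE_lt_four
  have hr1 := rho_gt; have hr2 := rho_lt; have hr0 := rho_pos
  have hV : 0 < V := by rw [← hTV]; positivity
  -- `ell a = ell(x,y,0)/ell b`, `N a = N(x,y,0)/N b`
  have hell : ell a * ell b = x + rho * y := by
    rw [← ell_mulVec, hab]; simp [ell]
  have hN : normForm a * normForm b = x ^ 3 + 2 * y ^ 3 := by
    rw [← normForm_mulVec, hab]; simp [normForm]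
  have hellb0 : 0 < ell b := lt_trans hT hb1
  have hNb0 : 0 < normForm b := lt_trans hV hNb1
  -- bounds for `ell a`: `X/(2T) < ell a < 5X/T`
  have hxy1 : 2 * X < x + rho * y := by nlinarith
  have hxy2 : x + rho * y < 5 * X := by nlinarith
  have hella_pos : 0 < ell a := by
    by_contra h; push Not at h
    have : ell a * ell b ≤ 0 := mul_nonpos_of_nonpos_of_nonneg h hellb0.le
    linarith
  have hella_hi : ell a * T < 5 * X := by
    calc ell a * T ≤ ell a * ell b := by gcongr
      _ = x + rho * y := hell
      _ < 5 * X := hxy2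
  have hella_lo : 2 * X < ell a * (4 * T) := by
    calc 2 * X < x + rho * y := hxy1
      _ = ell a * ell b := hell.symm
      _ ≤ ell a * (unitE * T) := by gcongr
      _ ≤ ell a * (4 * T) := by gcongr
  -- bound for `N a`: `0 < N a < 24 X³ / V`
  have hNa_hi : normForm a * V < 24 * X ^ 3 := by
    have hx0 : 0 ≤ x := by linarith
    have hy0 : 0 ≤ y := by linarith
    have hx3 : x ^ 3 ≤ (2 * X) ^ 3 := by gcongr
    have hy3 : y ^ 3 ≤ (2 * X) ^ 3 := by gcongr
    by_cases hNa : 0 < normForm a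
    · calc normForm a * V < normForm a * normForm b := by gcongr
        _ = x ^ 3 + 2 * y ^ 3 := hN
        _ ≤ 24 * X ^ 3 := by nlinarith
    · push Not at hNa
      have : normForm a * V ≤ 0 := mul_nonpos_of_nonpos_of_nonneg hNa hV.le
      have : 0 < 24 * X ^ 3 := by positivity
      linarith
  -- `quadQ a = N a / ell a < (24X³/V)·(2T/X)·... ≤ 48 X²/T²`
  have hQa : quadQ a * T ^ 2 ≤ 48 * X ^ 2 := by
    have hprod := ell_mul_quadQ a
    have hQ0 := quadQ_nonneg a
    -- `ell a * quadQ a * V < 24 X³` and `ell a * 4T > 2X`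
    have h1 : ell a * quadQ a * V < 24 * X ^ 3 := by rw [hprod]; exact hNa_hi
    -- multiply `hella_lo` by `quadQ a * V ≥ 0`
    by_contra h; push Not at h
    have h2 : 2 * X * (quadQ a * T ^ 2) ≥ 2 * X * (48 * X ^ 2) := by gcongr
    have h3 : ell a * (4 * T) * (quadQ a * T ^ 2) ≥ 2 * X * (quadQ a * T ^ 2) := by
      gcongr
    have h4 : ell a * (4 * T) * (quadQ a * T ^ 2) = 4 * (ell a * quadQ a * V) := by
      rw [← hTV]; ring
    nlinarith
  -- conclude: `ell² + 2Q ≤ 25X²/T² + 96X²/T² ≤ 3 (7X/T)²`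
  apply abs_coord_le (by positivity)
  have hT2 : 0 < T ^ 2 := by positivity
  rw [show 3 * (7 * X / T) ^ 2 = 147 * X ^ 2 / T ^ 2 by field_simp; ring]
  rw [le_div_iff₀ hT2]
  have he2 : ell a ^ 2 * T ^ 2 ≤ 25 * X ^ 2 := by
    have : ell a * T < 5 * X := hella_hi
    have h0 : 0 ≤ ell a * T := by positivity
    nlinarith
  nlinarith

/-- **(11.6), lower bound**: if the first coordinate of `α̂ β̂` exceeds `X > 0` and `|β̂_i| ≤ M`
then `|α̂|_∞ ≥ X/(5M)` ("`X V^{−1/3} ≪ |α̂|`"). [cite: HeathBrownActa2001, §11 (11.6)] -/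
theorem exists_abs_coord_alpha_ge {a b : ℝ × ℝ × ℝ} {X M : ℝ} (hM : 0 < M)
    (hb1 : |b.1| ≤ M) (hb2 : |b.2.1| ≤ M) (hb3 : |b.2.2| ≤ M) (hx : X < (mulVec a b).1) :
    X / (5 * M) < max |a.1| (max |a.2.1| |a.2.2|) := by
  by_contra h; push Not at h
  set A := max |a.1| (max |a.2.1| |a.2.2|) with hA
  have hA0 : 0 ≤ A := le_trans (abs_nonneg _) (le_max_left _ _)
  have h1 : |a.1| ≤ A := le_max_left _ _
  have h2 : |a.2.1| ≤ A := (le_max_left _ _).trans (le_max_right _ _)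
  have h3 : |a.2.2| ≤ A := (le_max_right _ _).trans (le_max_right _ _)
  have hfst : (mulVec a b).1 = a.1 * b.1 + 2 * a.2.1 * b.2.2 + 2 * a.2.2 * b.2.1 := rfl
  have hbound : (mulVec a b).1 ≤ 5 * A * M := by
    rw [hfst]
    have e1 : a.1 * b.1 ≤ A * M := by
      calc a.1 * b.1 ≤ |a.1 * b.1| := le_abs_self _
        _ = |a.1| * |b.1| := abs_mul _ _
        _ ≤ A * M := mul_le_mul h1 hb1 (abs_nonneg _) hA0
    have e2 : a.2.1 * b.2.2 ≤ A * M := by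
      calc a.2.1 * b.2.2 ≤ |a.2.1 * b.2.2| := le_abs_self _
        _ = |a.2.1| * |b.2.2| := abs_mul _ _
        _ ≤ A * M := mul_le_mul h2 hb3 (abs_nonneg _) hA0
    have e3 : a.2.2 * b.2.1 ≤ A * M := by
      calc a.2.2 * b.2.1 ≤ |a.2.2 * b.2.1| := le_abs_self _
        _ = |a.2.2| * |b.2.1| := abs_mul _ _
        _ ≤ A * M := mul_le_mul h3 hb2 (abs_nonneg _) hA0
    linarith
  have : 5 * A * M ≤ 5 * (X / (5 * M)) * M := by gcongr
  rw [show 5 * (X / (5 * M)) * M = X by field_simp] at this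
  linarith

end Literature.NumberTheory.Sieve.CubicSieve

end
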